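import Summits.CriticalPhenomena.SAWScalingLimit.Theorems.SAWDevelopingMapObservableToSLETypeLadderCarvedReductionSqueezeMultiLimits
import Summits.CriticalPhenomena.SAWScalingLimit.Theorems.SAWDefectDecoherenceObservableToSLERNestedGateDefs
import Summits.CriticalPhenomena.SAWScalingLimit.Theorems.SAWDefectDecoherenceObservableToSLERNestedLinkDefs
import Summits.CriticalPhenomena.SAWScalingLimit.Theorems.SAWDefectDecoherenceObservableToSLERClassZeroAudit
import Literature.Probability.RandomPlanarGeometry.HexSAW
import HarnessLib

/-!
# THE LIMIT PACKAGE of the moving-carving squeeze along one subsequence (piece (T-A lim-f) of stub T-A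
# `stub_carvedReduction_squeezeGeometry`)

Crux `SAWDevelopingMap.ObservableToSLE` (stmt-CriticalPhenomena-10472), line `six-class-type-ladder`,
stub T-A `stub_carvedReduction_squeezeGeometry`.  Landing target:
`Summits/CriticalPhenomena/SAWScalingLimit/Theorems/SAWDevelopingMapObservableToSLETypeLadderCarvedReductionSqueezeLimitPackage.lean`
(`--supports stmt-CriticalPhenomena-10472`).  Sequel of `…SqueezeMultiLimits`
(`cells_limits_roots`, `fats_limits`) and `…SqueezeCellLimits` (`exists_cells_of_list`); input:
STAGE 1a `TypeLadder.carvedReduction_squeezeGeometry_selection` (p137830).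

Memo item 2 of the T-A plan, ASSEMBLED: from the hypotheses of the squeeze (tame nested fat
class-zero SOLID families `S`, `T`, realised first good gates) and the pinned frame of STAGE 1a
along an index map `κ` (meshes `s_j = δ (κ j) → 0⁺`, translations `x_j`, `s_j · triEmbed x_j → τ`,
gates `s_j c_{q_j} → P₀ + τ`, `s_j c_{q'_j} → P₁ + τ`), ONE further subsequence `ψ` along which,
in the pinned frame `z ↦ z - s_j · triEmbed x_j`:
* the removed levels `S_j(n_j)`, `T_j(n'_j)` are EXACTLY unions of `N` tracked hexagons whose
  pinned centres and radii converge (limit hexagons `Hex(CS i, ϱS i)`, `Hex(CT i, ϱT i)` within `R`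
  of the pinned roots `D.pt 0 - τ`, `D.pt 1 - τ`), with PERSISTENCE (shrunken limit hexagons are
  removed), CONTAINMENT (removed vertices lie in thickened limit hexagons) and EVENTUAL CARVING of
  every compact set missing all limit hexagons;
* the fat SPINES converge (Hausdorff) to compact connected `KS ∋ D.pt 0 - τ`, `KT ∋ D.pt 1 - τ`
  whose `ρ/8`-cores are persistently removed, the dipping clause carried along;
* the fat BODIES under the realised windows converge to compact connected `BS ∋ D.pt 0 - τ,
  P₀ - (ρ/2) i` and `BT ∋ D.pt 1 - τ, P₁ - (ρ/2) i` whose `ρ/4`-cores are persistently removed.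
This is the continuum input of the super-domain / inner-domain constructions (STAGE 1b).
Registered carrier: `stub_carvedReduction_tendsto_pinned_root`.
-/

noncomputable section

open scoped Topology
open Filter Set Metric TopologicalSpace
open Literature.Probability.LatticeModels (HexVertex hexGraph hexCenter triZeta triEmbed Site)
open Literature.Probability.RandomPlanarGeometry
open Literature.Probability.RandomPlanarGeometry.SAW

namespace Summit.CriticalPhenomena.SAWScalingLimit.Theorems.ObservableToSLE.TypeLadder

open Summit.CriticalPhenomena.SAWScalingLimit.Theorems.ObservableToSLER.BridgeGate
open Summit.CriticalPhenomena.SAWScalingLimit.Theorems.ObservableToSLER.NestedGate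

/-! ### Pinned roots converge -/

/-- Along meshes `s_j → 0⁺` with `s_j · triEmbed x_j → τ`, the pinned rescaled roots converge:
`s_j c_{a(s_j)} - s_j · triEmbed x_j → D.pt 0 - τ` (and likewise at `b`). -/
theorem tendsto_pinned_root {u : ℕ → ℂ} {s : ℕ → ℝ} {x : ℕ → Site 2} {p τ : ℂ}
    (hu : Tendsto u atTop (𝓝 p)) (hτ : Tendsto (fun j => (s j : ℂ) * triEmbed (x j)) atTop (𝓝 τ)) :
    Tendsto (fun j => u j - (s j : ℂ) * triEmbed (x j)) atTop (𝓝 (p - τ)) :=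
  hu.sub hτ

/-- **Registered sub-goal `stub_carvedReduction_tendsto_pinned_root`** (crux item
stmt-CriticalPhenomena-10472, stub T-A `stub_carvedReduction_squeezeGeometry`, piece (T-A lim-f)). -/
theorem stub_carvedReduction_tendsto_pinned_root :
    ∀ (u : ℕ → ℂ) (s : ℕ → ℝ) (x : ℕ → Site 2) (p τ : ℂ), Tendsto u atTop (𝓝 p) →
      Tendsto (fun j => (s j : ℂ) * triEmbed (x j)) atTop (𝓝 τ) →
      Tendsto (fun j => u j - (s j : ℂ) * triEmbed (x j)) atTop (𝓝 (p - τ)) :=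
  fun _ _ _ _ _ hu hτ => tendsto_pinned_root hu hτ

/-! ### The package -/

/-- **THE LIMIT PACKAGE**; see the module docstring.  Notation in the conclusion:
`s' j = δ (κ (ψ j))`, `τ' j = s' j · triEmbed (x (ψ j))`, `LS j = S (κ (ψ j)) (n (κ (ψ j)))`,
`LT j = T (κ (ψ j)) (n' (κ (ψ j)))`. -/
theorem squeeze_limitPackage (D : DobrushinDomain) (a b : ℝ → HexVertex)
    (hab : IsEmbEndpointApprox hexGraph hexCenter D a b) {R ρ : ℝ} {N : ℕ} {δ : ℕ → ℝ}
    {S T : ℕ → ℕ → Set HexVertex} {n n' : ℕ → ℕ} {q q' : ℕ → HexVertex} (hρ : 0 < ρ)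
    (hfam : ∀ k, TameNestedFamily (δ k) R N (a (δ k)) (S k) ∧ TameNestedFamily (δ k) R N (b (δ k)) (T k) ∧
      (∀ i : ℕ, ∃ K : Set ℂ, IsCompact K ∧ IsConnected K ∧ ((δ k : ℝ) : ℂ) * hexCenter (a (δ k)) ∈ K ∧
        (∀ v : HexVertex, Metric.infDist (((δ k : ℝ) : ℂ) * hexCenter v) K ≤ ρ / 8 → v ∈ S k i) ∧
        (∀ v ∈ S k i, ∃ (t w : HexVertex) (r : ℕ), v ∈ hexBall t r ∧ w ∈ hexBall t r ∧
          hexBall t r ⊆ S k i ∧ Metric.infDist (((δ k : ℝ) : ℂ) * hexCenter w) K ≤ ρ / 16)) ∧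
      (∀ i : ℕ, ∃ K : Set ℂ, IsCompact K ∧ IsConnected K ∧ ((δ k : ℝ) : ℂ) * hexCenter (b (δ k)) ∈ K ∧
        (∀ v : HexVertex, Metric.infDist (((δ k : ℝ) : ℂ) * hexCenter v) K ≤ ρ / 8 → v ∈ T k i) ∧
        (∀ v ∈ T k i, ∃ (t w : HexVertex) (r : ℕ), v ∈ hexBall t r ∧ w ∈ hexBall t r ∧
          hexBall t r ⊆ T k i ∧ Metric.infDist (((δ k : ℝ) : ℂ) * hexCenter w) K ≤ ρ / 16)))
    (hbody : ∀ k, (∃ K : Set ℂ, IsCompact K ∧ IsConnected K ∧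
        ((δ k : ℝ) : ℂ) * hexCenter (q k) - ((ρ / 2 : ℝ) : ℂ) * Complex.I ∈ K ∧ ((δ k : ℝ) : ℂ) * hexCenter (a (δ k)) ∈ K ∧
        ∀ v : HexVertex, Metric.infDist (((δ k : ℝ) : ℂ) * hexCenter v) K ≤ ρ / 4 → v ∈ S k (n k)) ∧
      (∃ K : Set ℂ, IsCompact K ∧ IsConnected K ∧
        ((δ k : ℝ) : ℂ) * hexCenter (q' k) - ((ρ / 2 : ℝ) : ℂ) * Complex.I ∈ K ∧ ((δ k : ℝ) : ℂ) * hexCenter (b (δ k)) ∈ K ∧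
        ∀ v : HexVertex, Metric.infDist (((δ k : ℝ) : ℂ) * hexCenter v) K ≤ ρ / 4 → v ∈ T k (n' k)))
    {κ : ℕ → ℕ} {x : ℕ → Site 2} {τ P₀ P₁ : ℂ} (hspos : ∀ j, 0 < δ (κ j))
    (hs0 : Tendsto (fun j => δ (κ j)) atTop (𝓝[>] 0))
    (hτ : Tendsto (fun j => ((δ (κ j) : ℝ) : ℂ) * triEmbed (x j)) atTop (𝓝 τ))
    (hq : Tendsto (fun j => ((δ (κ j) : ℝ) : ℂ) * hexCenter (q (κ j))) atTop (𝓝 (P₀ + τ)))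
    (hq' : Tendsto (fun j => ((δ (κ j) : ℝ) : ℂ) * hexCenter (q' (κ j))) atTop (𝓝 (P₁ + τ))) :
    ∃ (ψ : ℕ → ℕ) (gS gT : ℕ → Fin N → HexVertex × ℕ) (CS CT : Fin N → ℂ) (ϱS ϱT : Fin N → ℝ)
      (KS KT BS BT : Set ℂ) (KpS KpT BpS BpT : ℕ → Set ℂ), StrictMono ψ ∧
      -- the removed levels are exactly the tracked hexagons
      (∀ j (v : HexVertex), v ∈ S (κ (ψ j)) (n (κ (ψ j))) ↔ ∃ i, v ∈ hexBall (gS j i).1 (gS j i).2) ∧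
      (∀ j (v : HexVertex), v ∈ T (κ (ψ j)) (n' (κ (ψ j))) ↔ ∃ i, v ∈ hexBall (gT j i).1 (gT j i).2) ∧
      -- limit hexagons
      (∀ i, 0 ≤ ϱS i ∧ dist (CS i) (D.pt 0 - τ) ≤ R) ∧ (∀ i, 0 ≤ ϱT i ∧ dist (CT i) (D.pt 1 - τ) ≤ R) ∧
      (∀ i, Tendsto (fun j => ((δ (κ (ψ j)) : ℝ) : ℂ) * hexCenter (gS j i).1 -
        ((δ (κ (ψ j)) : ℝ) : ℂ) * triEmbed (x (ψ j))) atTop (𝓝 (CS i)) ∧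
        Tendsto (fun j => δ (κ (ψ j)) * ((gS j i).2 + 1 / 2)) atTop (𝓝 (ϱS i))) ∧
      (∀ i, Tendsto (fun j => ((δ (κ (ψ j)) : ℝ) : ℂ) * hexCenter (gT j i).1 -
        ((δ (κ (ψ j)) : ℝ) : ℂ) * triEmbed (x (ψ j))) atTop (𝓝 (CT i)) ∧
        Tendsto (fun j => δ (κ (ψ j)) * ((gT j i).2 + 1 / 2)) atTop (𝓝 (ϱT i))) ∧
      -- persistence
      (∀ ε > (0 : ℝ), ∀ᶠ j in atTop, ∀ (i : Fin N) (v : HexVertex),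
        ((∀ ℓ : Fin 3, |skewCoord ℓ (((δ (κ (ψ j)) : ℝ) : ℂ) * hexCenter v -
            ((δ (κ (ψ j)) : ℝ) : ℂ) * triEmbed (x (ψ j)) - CS i)| ≤ ϱS i - ε) → v ∈ S (κ (ψ j)) (n (κ (ψ j)))) ∧
        ((∀ ℓ : Fin 3, |skewCoord ℓ (((δ (κ (ψ j)) : ℝ) : ℂ) * hexCenter v -
            ((δ (κ (ψ j)) : ℝ) : ℂ) * triEmbed (x (ψ j)) - CT i)| ≤ ϱT i - ε) → v ∈ T (κ (ψ j)) (n' (κ (ψ j))))) ∧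
      -- containment
      (∀ ε > (0 : ℝ), ∀ᶠ j in atTop,
        (∀ v ∈ S (κ (ψ j)) (n (κ (ψ j))), ∃ i : Fin N, ∀ ℓ : Fin 3,
          |skewCoord ℓ (((δ (κ (ψ j)) : ℝ) : ℂ) * hexCenter v - ((δ (κ (ψ j)) : ℝ) : ℂ) * triEmbed (x (ψ j)) - CS i)| ≤
            ϱS i + ε) ∧
        (∀ v ∈ T (κ (ψ j)) (n' (κ (ψ j))), ∃ i : Fin N, ∀ ℓ : Fin 3,
          |skewCoord ℓ (((δ (κ (ψ j)) : ℝ) : ℂ) * hexCenter v - ((δ (κ (ψ j)) : ℝ) : ℂ) * triEmbed (x (ψ j)) - CT i)| ≤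
            ϱT i + ε)) ∧
      -- eventual carving of compacts
      (∀ K : Set ℂ, IsCompact K → (∀ i, Disjoint K {z : ℂ | ∀ ℓ : Fin 3, |skewCoord ℓ (z - CS i)| ≤ ϱS i}) →
        (∀ i, Disjoint K {z : ℂ | ∀ ℓ : Fin 3, |skewCoord ℓ (z - CT i)| ≤ ϱT i}) →
        ∀ᶠ j in atTop, ∀ v : HexVertex, v ∈ S (κ (ψ j)) (n (κ (ψ j))) ∪ T (κ (ψ j)) (n' (κ (ψ j))) →
          ((δ (κ (ψ j)) : ℝ) : ℂ) * hexCenter v - ((δ (κ (ψ j)) : ℝ) : ℂ) * triEmbed (x (ψ j)) ∉ K) ∧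
      -- spines
      (IsCompact KS ∧ IsConnected KS ∧ D.pt 0 - τ ∈ KS ∧ KS ⊆ closedBall (D.pt 0 - τ) (R + 1)) ∧
      (IsCompact KT ∧ IsConnected KT ∧ D.pt 1 - τ ∈ KT ∧ KT ⊆ closedBall (D.pt 1 - τ) (R + 1)) ∧
      (∀ j, IsCompact (KpS j) ∧ IsConnected (KpS j) ∧
        (∀ v : HexVertex, infDist (((δ (κ (ψ j)) : ℝ) : ℂ) * hexCenter v - ((δ (κ (ψ j)) : ℝ) : ℂ) * triEmbed (x (ψ j)))
          (KpS j) ≤ ρ / 8 → v ∈ S (κ (ψ j)) (n (κ (ψ j)))) ∧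
        (∀ v ∈ S (κ (ψ j)) (n (κ (ψ j))), ∃ (t w : HexVertex) (r : ℕ), v ∈ hexBall t r ∧ w ∈ hexBall t r ∧
          hexBall t r ⊆ S (κ (ψ j)) (n (κ (ψ j))) ∧
          infDist (((δ (κ (ψ j)) : ℝ) : ℂ) * hexCenter w - ((δ (κ (ψ j)) : ℝ) : ℂ) * triEmbed (x (ψ j))) (KpS j) ≤ ρ / 16)) ∧
      (∀ j, IsCompact (KpT j) ∧ IsConnected (KpT j) ∧
        (∀ v : HexVertex, infDist (((δ (κ (ψ j)) : ℝ) : ℂ) * hexCenter v - ((δ (κ (ψ j)) : ℝ) : ℂ) * triEmbed (x (ψ j)))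
          (KpT j) ≤ ρ / 8 → v ∈ T (κ (ψ j)) (n' (κ (ψ j)))) ∧
        (∀ v ∈ T (κ (ψ j)) (n' (κ (ψ j))), ∃ (t w : HexVertex) (r : ℕ), v ∈ hexBall t r ∧ w ∈ hexBall t r ∧
          hexBall t r ⊆ T (κ (ψ j)) (n' (κ (ψ j))) ∧
          infDist (((δ (κ (ψ j)) : ℝ) : ℂ) * hexCenter w - ((δ (κ (ψ j)) : ℝ) : ℂ) * triEmbed (x (ψ j))) (KpT j) ≤ ρ / 16)) ∧
      Tendsto (fun j => hausdorffDist (KpS j) KS) atTop (𝓝 0) ∧ Tendsto (fun j => hausdorffDist (KpT j) KT) atTop (𝓝 0) ∧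
      (∀ ε > (0 : ℝ), ∀ᶠ j in atTop, ∀ v : HexVertex,
        (infDist (((δ (κ (ψ j)) : ℝ) : ℂ) * hexCenter v - ((δ (κ (ψ j)) : ℝ) : ℂ) * triEmbed (x (ψ j))) KS ≤ ρ / 8 - ε →
          v ∈ S (κ (ψ j)) (n (κ (ψ j)))) ∧
        (infDist (((δ (κ (ψ j)) : ℝ) : ℂ) * hexCenter v - ((δ (κ (ψ j)) : ℝ) : ℂ) * triEmbed (x (ψ j))) KT ≤ ρ / 8 - ε →
          v ∈ T (κ (ψ j)) (n' (κ (ψ j))))) ∧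
      -- bodies
      (IsCompact BS ∧ IsConnected BS ∧ D.pt 0 - τ ∈ BS ∧ P₀ - ((ρ / 2 : ℝ) : ℂ) * Complex.I ∈ BS ∧
        BS ⊆ closedBall (D.pt 0 - τ) (R + 1)) ∧
      (IsCompact BT ∧ IsConnected BT ∧ D.pt 1 - τ ∈ BT ∧ P₁ - ((ρ / 2 : ℝ) : ℂ) * Complex.I ∈ BT ∧
        BT ⊆ closedBall (D.pt 1 - τ) (R + 1)) ∧
      (∀ j, IsCompact (BpS j) ∧ IsConnected (BpS j) ∧
        (∀ v : HexVertex, infDist (((δ (κ (ψ j)) : ℝ) : ℂ) * hexCenter v - ((δ (κ (ψ j)) : ℝ) : ℂ) * triEmbed (x (ψ j)))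
          (BpS j) ≤ ρ / 4 → v ∈ S (κ (ψ j)) (n (κ (ψ j))))) ∧
      (∀ j, IsCompact (BpT j) ∧ IsConnected (BpT j) ∧
        (∀ v : HexVertex, infDist (((δ (κ (ψ j)) : ℝ) : ℂ) * hexCenter v - ((δ (κ (ψ j)) : ℝ) : ℂ) * triEmbed (x (ψ j)))
          (BpT j) ≤ ρ / 4 → v ∈ T (κ (ψ j)) (n' (κ (ψ j))))) ∧
      Tendsto (fun j => hausdorffDist (BpS j) BS) atTop (𝓝 0) ∧ Tendsto (fun j => hausdorffDist (BpT j) BT) atTop (𝓝 0) ∧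
      (∀ ε > (0 : ℝ), ∀ᶠ j in atTop, ∀ v : HexVertex,
        (infDist (((δ (κ (ψ j)) : ℝ) : ℂ) * hexCenter v - ((δ (κ (ψ j)) : ℝ) : ℂ) * triEmbed (x (ψ j))) BS ≤ ρ / 4 - ε →
          v ∈ S (κ (ψ j)) (n (κ (ψ j)))) ∧
        (infDist (((δ (κ (ψ j)) : ℝ) : ℂ) * hexCenter v - ((δ (κ (ψ j)) : ℝ) : ℂ) * triEmbed (x (ψ j))) BT ≤ ρ / 4 - ε →
          v ∈ T (κ (ψ j)) (n' (κ (ψ j))))) := by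
  classical
  -- Step 0: the data along `κ`
  set s : ℕ → ℝ := fun j => δ (κ j) with hsdef
  set τj : ℕ → ℂ := fun j => ((δ (κ j) : ℝ) : ℂ) * triEmbed (x j) with hτjdef
  have hs0' : Tendsto (fun j => δ (κ j)) atTop (𝓝 0) := tendsto_nhds_of_tendsto_nhdsWithin hs0
  have haroot : Tendsto (fun j => ((δ (κ j) : ℝ) : ℂ) * hexCenter (a (δ (κ j))) - ((δ (κ j) : ℝ) : ℂ) * triEmbed (x j))
      atTop (𝓝 (D.pt 0 - τ)) := tendsto_pinned_root (hab.tendsto_fst.comp hs0) hτ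
  have hbroot : Tendsto (fun j => ((δ (κ j) : ℝ) : ℂ) * hexCenter (b (δ (κ j))) - ((δ (κ j) : ℝ) : ℂ) * triEmbed (x j))
      atTop (𝓝 (D.pt 1 - τ)) := tendsto_pinned_root (hab.tendsto_snd.comp hs0) hτ
  -- cells of both levels
  have hcellS : ∀ j, ∃ g : Fin N → HexVertex × ℕ,
      (∀ v : HexVertex, v ∈ S (κ j) (n (κ j)) ↔ ∃ i, v ∈ hexBall (g i).1 (g i).2) ∧
      (∀ i, hexBall (g i).1 (g i).2 ⊆ S (κ j) (n (κ j))) := by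
    intro j
    obtain ⟨hSt, -, -, -⟩ := hfam (κ j)
    obtain ⟨Lst, hlen, hLst⟩ := hSt.2.2.2.2 (n (κ j))
    obtain ⟨g, h1, -, h3, -⟩ := exists_cells_of_list hlen hLst (hSt.2.1 (n (κ j)))
    exact ⟨g, h1, h3⟩
  have hcellT : ∀ j, ∃ g : Fin N → HexVertex × ℕ,
      (∀ v : HexVertex, v ∈ T (κ j) (n' (κ j)) ↔ ∃ i, v ∈ hexBall (g i).1 (g i).2) ∧
      (∀ i, hexBall (g i).1 (g i).2 ⊆ T (κ j) (n' (κ j))) := by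
    intro j
    obtain ⟨-, hTt, -, -⟩ := hfam (κ j)
    obtain ⟨Lst, hlen, hLst⟩ := hTt.2.2.2.2 (n' (κ j))
    obtain ⟨g, h1, -, h3, -⟩ := exists_cells_of_list hlen hLst (hTt.2.1 (n' (κ j)))
    exact ⟨g, h1, h3⟩
  choose gS0 hgS0 hgS0sub using hcellS
  choose gT0 hgT0 hgT0sub using hcellT
  -- Step 1: cells of both families at once (index `Bool × Fin N`, `false` = S, `true` = T)
  set g : ℕ → Bool × Fin N → HexVertex × ℕ := fun j p => cond p.1 (gT0 j p.2) (gS0 j p.2) with hgdef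
  set root : ℕ → Bool × Fin N → HexVertex := fun j p => cond p.1 (b (δ (κ j))) (a (δ (κ j))) with hrootdef
  set ℓ : Bool × Fin N → ℂ := fun p => cond p.1 (D.pt 1 - τ) (D.pt 0 - τ) with hℓdef
  have hloc : ∀ j p, ∀ v ∈ hexBall (g j p).1 (g j p).2,
      dist (((s j : ℝ) : ℂ) * hexCenter v) (((s j : ℝ) : ℂ) * hexCenter (root j p)) ≤ R := by
    rintro j ⟨β, i⟩ v hv
    obtain ⟨hSt, hTt, -, -⟩ := hfam (κ j)
    cases β
    · exact hSt.2.2.1 _ v (hgS0sub j i hv)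
    · exact hTt.2.2.1 _ v (hgT0sub j i hv)
  have hrootlim : ∀ p, Tendsto (fun j => ((s j : ℝ) : ℂ) * hexCenter (root j p) - τj j) atTop (𝓝 (ℓ p)) := by
    rintro ⟨β, i⟩
    cases β
    · exact haroot
    · exact hbroot
  obtain ⟨ψ₁, C, ϱ, hψ₁, hϱnn, hCR, hClim, hϱlim, hpers, hcont, hcomp⟩ :=
    cells_limits_roots (g := g) (root := root) (ℓ₀ := ℓ) hspos hs0' hloc hrootlim
  -- Step 2: the four fat sets at once along `κ ∘ ψ₁` (index `Bool × Bool`: family, spine/body)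
  set κ₁ : ℕ → ℕ := fun j => κ (ψ₁ j) with hκ₁
  set L4 : Bool × Bool → ℕ → Set HexVertex := fun p j =>
    cond p.1 (T (κ₁ j) (n' (κ₁ j))) (S (κ₁ j) (n (κ₁ j))) with hL4
  set root4 : Bool × Bool → ℕ → HexVertex := fun p j => cond p.1 (b (δ (κ₁ j))) (a (δ (κ₁ j))) with hroot4
  set r4 : Bool × Bool → ℝ := fun p => cond p.2 (ρ / 4) (ρ / 8) with hr4
  set ℓ4 : Bool × Bool → ℂ := fun p => cond p.1 (D.pt 1 - τ) (D.pt 0 - τ) with hℓ4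
  set P4 : Bool × Bool → ℕ → Set ℂ → Prop := fun p j K =>
    cond p.2
      (((δ (κ₁ j) : ℝ) : ℂ) * hexCenter (cond p.1 (q' (κ₁ j)) (q (κ₁ j))) - ((ρ / 2 : ℝ) : ℂ) * Complex.I ∈ K)
      (∀ v ∈ L4 p j, ∃ (t w : HexVertex) (r : ℕ), v ∈ hexBall t r ∧ w ∈ hexBall t r ∧ hexBall t r ⊆ L4 p j ∧
        infDist (((δ (κ₁ j) : ℝ) : ℂ) * hexCenter w) K ≤ ρ / 16) with hP4
  have hr4pos : ∀ p, 0 < r4 p := by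
    rintro ⟨β₁, β₂⟩; cases β₂ <;> simp only [hr4, cond] <;> positivity
  have hspos₁ : ∀ j, 0 < δ (κ₁ j) := fun j => hspos _
  have hs0₁ : Tendsto (fun j => δ (κ₁ j)) atTop (𝓝 0) := hs0'.comp hψ₁.tendsto_atTop
  have hloc4 : ∀ p j, ∀ v ∈ L4 p j,
      dist (((δ (κ₁ j) : ℝ) : ℂ) * hexCenter v) (((δ (κ₁ j) : ℝ) : ℂ) * hexCenter (root4 p j)) ≤ R := by
    rintro ⟨β₁, β₂⟩ j v hv
    obtain ⟨hSt, hTt, -, -⟩ := hfam (κ₁ j)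
    cases β₁
    · exact hSt.2.2.1 _ v hv
    · exact hTt.2.2.1 _ v hv
  have hfat4 : ∀ p j, ∃ K : Set ℂ, IsCompact K ∧ IsConnected K ∧ ((δ (κ₁ j) : ℝ) : ℂ) * hexCenter (root4 p j) ∈ K ∧
      (∀ v : HexVertex, infDist (((δ (κ₁ j) : ℝ) : ℂ) * hexCenter v) K ≤ r4 p → v ∈ L4 p j) ∧ P4 p j K := by
    rintro ⟨β₁, β₂⟩ j
    obtain ⟨-, -, hspS, hspT⟩ := hfam (κ₁ j)
    obtain ⟨hbS, hbT⟩ := hbody (κ₁ j)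
    cases β₁ <;> cases β₂
    · obtain ⟨K, h1, h2, h3, h4, h5⟩ := hspS (n (κ₁ j))
      exact ⟨K, h1, h2, h3, h4, h5⟩
    · obtain ⟨K, h1, h2, h3, h4, h5⟩ := hbS
      exact ⟨K, h1, h2, h4, h5, h3⟩
    · obtain ⟨K, h1, h2, h3, h4, h5⟩ := hspT (n' (κ₁ j))
      exact ⟨K, h1, h2, h3, h4, h5⟩
    · obtain ⟨K, h1, h2, h3, h4, h5⟩ := hbT
      exact ⟨K, h1, h2, h4, h5, h3⟩
  have hrootlim4 : ∀ p, Tendsto (fun j => ((δ (κ₁ j) : ℝ) : ℂ) * hexCenter (root4 p j) -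
      ((δ (κ₁ j) : ℝ) : ℂ) * triEmbed (x (ψ₁ j))) atTop (𝓝 (ℓ4 p)) := by
    rintro ⟨β₁, β₂⟩
    cases β₁
    · exact haroot.comp hψ₁.tendsto_atTop
    · exact hbroot.comp hψ₁.tendsto_atTop
  obtain ⟨ψ₂, Kinf, Ko, Kp, hψ₂, hall⟩ := fats_limits (L := L4) (root := root4) (r₀ := r4) (ℓ₀ := ℓ4) (P := P4)
    (τ := fun j => ((δ (κ₁ j) : ℝ) : ℂ) * triEmbed (x (ψ₁ j))) hr4pos hspos₁ hs0₁ hloc4 hfat4 hrootlim4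
  -- the final subsequence
  set ψ : ℕ → ℕ := fun j => ψ₁ (ψ₂ j) with hψdef
  have hψ : StrictMono ψ := hψ₁.comp hψ₂
  have hT₂ : Tendsto ψ₂ atTop atTop := hψ₂.tendsto_atTop
  -- unpack the four fat packages
  obtain ⟨hSS1, hSS2, hSS3, hSS4, hSSo, hSSp, hSSH, hSScore⟩ := hall (false, false)
  obtain ⟨hTS1, hTS2, hTS3, hTS4, hTSo, hTSp, hTSH, hTScore⟩ := hall (true, false)
  obtain ⟨hSB1, hSB2, hSB3, hSB4, hSBo, hSBp, hSBH, hSBcore⟩ := hall (false, true)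
  obtain ⟨hTB1, hTB2, hTB3, hTB4, hTBo, hTBp, hTBH, hTBcore⟩ := hall (true, true)
  -- body points are in the limit bodies
  have hqpin : Tendsto (fun j => ((δ (κ₁ (ψ₂ j)) : ℝ) : ℂ) * hexCenter (q (κ₁ (ψ₂ j))) -
      ((ρ / 2 : ℝ) : ℂ) * Complex.I - ((δ (κ₁ (ψ₂ j)) : ℝ) : ℂ) * triEmbed (x (ψ₁ (ψ₂ j)))) atTop
      (𝓝 (P₀ - ((ρ / 2 : ℝ) : ℂ) * Complex.I)) := by
    have h1 := ((tendsto_pinned_root hq hτ).comp hψ₁.tendsto_atTop).comp hT₂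
    have h2 : Tendsto (fun j => ((δ (κ₁ (ψ₂ j)) : ℝ) : ℂ) * hexCenter (q (κ₁ (ψ₂ j))) -
        ((δ (κ₁ (ψ₂ j)) : ℝ) : ℂ) * triEmbed (x (ψ₁ (ψ₂ j))) - ((ρ / 2 : ℝ) : ℂ) * Complex.I) atTop
        (𝓝 (P₀ + τ - τ - ((ρ / 2 : ℝ) : ℂ) * Complex.I)) := h1.sub tendsto_const_nhds
    rw [add_sub_cancel_right] at h2
    refine h2.congr fun j => by ring
  have hq'pin : Tendsto (fun j => ((δ (κ₁ (ψ₂ j)) : ℝ) : ℂ) * hexCenter (q' (κ₁ (ψ₂ j))) -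
      ((ρ / 2 : ℝ) : ℂ) * Complex.I - ((δ (κ₁ (ψ₂ j)) : ℝ) : ℂ) * triEmbed (x (ψ₁ (ψ₂ j)))) atTop
      (𝓝 (P₁ - ((ρ / 2 : ℝ) : ℂ) * Complex.I)) := by
    have h1 := ((tendsto_pinned_root hq' hτ).comp hψ₁.tendsto_atTop).comp hT₂
    have h2 : Tendsto (fun j => ((δ (κ₁ (ψ₂ j)) : ℝ) : ℂ) * hexCenter (q' (κ₁ (ψ₂ j))) -
        ((δ (κ₁ (ψ₂ j)) : ℝ) : ℂ) * triEmbed (x (ψ₁ (ψ₂ j))) - ((ρ / 2 : ℝ) : ℂ) * Complex.I) atTop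
        (𝓝 (P₁ + τ - τ - ((ρ / 2 : ℝ) : ℂ) * Complex.I)) := h1.sub tendsto_const_nhds
    rw [add_sub_cancel_right] at h2
    refine h2.congr fun j => by ring
  have hP₀B : P₀ - ((ρ / 2 : ℝ) : ℂ) * Complex.I ∈ Kinf (false, true) := by
    refine mem_fatLimit_of_tendsto (fun j => ⟨(hSBp j).1, ⟨_, (hSBp j).2.2.1⟩⟩) hSB1 ⟨_, hSB3⟩ hSBH
      (fun j => ?_) hqpin
    rw [(hSBo j).1]
    exact ⟨_, (hSBo j).2.2.2.2.2, rfl⟩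
  have hP₁B : P₁ - ((ρ / 2 : ℝ) : ℂ) * Complex.I ∈ Kinf (true, true) := by
    refine mem_fatLimit_of_tendsto (fun j => ⟨(hTBp j).1, ⟨_, (hTBp j).2.2.1⟩⟩) hTB1 ⟨_, hTB3⟩ hTBH
      (fun j => ?_) hq'pin
    rw [(hTBo j).1]
    exact ⟨_, (hTBo j).2.2.2.2.2, rfl⟩
  -- dipping clauses, pinned
  have hdipS : ∀ j, ∀ v ∈ S (κ₁ (ψ₂ j)) (n (κ₁ (ψ₂ j))), ∃ (t w : HexVertex) (r : ℕ), v ∈ hexBall t r ∧ w ∈ hexBall t r ∧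
      hexBall t r ⊆ S (κ₁ (ψ₂ j)) (n (κ₁ (ψ₂ j))) ∧
      infDist (((δ (κ₁ (ψ₂ j)) : ℝ) : ℂ) * hexCenter w - ((δ (κ₁ (ψ₂ j)) : ℝ) : ℂ) * triEmbed (x (ψ₁ (ψ₂ j))))
        (Kp (false, false) j) ≤ ρ / 16 := by
    intro j v hv
    obtain ⟨t, w, r, h1, h2, h3, h4⟩ := (hSSo j).2.2.2.2.2 v hv
    refine ⟨t, w, r, h1, h2, h3, ?_⟩
    rw [(hSSo j).1, infDist_sub_image]; exact h4
  have hdipT : ∀ j, ∀ v ∈ T (κ₁ (ψ₂ j)) (n' (κ₁ (ψ₂ j))), ∃ (t w : HexVertex) (r : ℕ), v ∈ hexBall t r ∧ w ∈ hexBall t r ∧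
      hexBall t r ⊆ T (κ₁ (ψ₂ j)) (n' (κ₁ (ψ₂ j))) ∧
      infDist (((δ (κ₁ (ψ₂ j)) : ℝ) : ℂ) * hexCenter w - ((δ (κ₁ (ψ₂ j)) : ℝ) : ℂ) * triEmbed (x (ψ₁ (ψ₂ j))))
        (Kp (true, false) j) ≤ ρ / 16 := by
    intro j v hv
    obtain ⟨t, w, r, h1, h2, h3, h4⟩ := (hTSo j).2.2.2.2.2 v hv
    refine ⟨t, w, r, h1, h2, h3, ?_⟩
    rw [(hTSo j).1, infDist_sub_image]; exact h4
  refine ⟨ψ, fun j i => gS0 (ψ j) i, fun j i => gT0 (ψ j) i, fun i => C (false, i), fun i => C (true, i),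
    fun i => ϱ (false, i), fun i => ϱ (true, i), Kinf (false, false), Kinf (true, false), Kinf (false, true),
    Kinf (true, true), Kp (false, false), Kp (true, false), Kp (false, true), Kp (true, true), hψ,
    fun j v => hgS0 (ψ j) v, fun j v => hgT0 (ψ j) v,
    fun i => ⟨hϱnn (false, i), hCR (false, i)⟩, fun i => ⟨hϱnn (true, i), hCR (true, i)⟩,
    fun i => ⟨(hClim (false, i)).comp hT₂, (hϱlim (false, i)).comp hT₂⟩,
    fun i => ⟨(hClim (true, i)).comp hT₂, (hϱlim (true, i)).comp hT₂⟩, ?_, ?_, ?_,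
    ⟨hSS1, hSS2, hSS3, hSS4⟩, ⟨hTS1, hTS2, hTS3, hTS4⟩,
    fun j => ⟨(hSSp j).1, (hSSp j).2.1, (hSSp j).2.2.2.2, hdipS j⟩,
    fun j => ⟨(hTSp j).1, (hTSp j).2.1, (hTSp j).2.2.2.2, hdipT j⟩, hSSH, hTSH, ?_,
    ⟨hSB1, hSB2, hSB3, hP₀B, hSB4⟩, ⟨hTB1, hTB2, hTB3, hP₁B, hTB4⟩,
    fun j => ⟨(hSBp j).1, (hSBp j).2.1, (hSBp j).2.2.2.2⟩, fun j => ⟨(hTBp j).1, (hTBp j).2.1, (hTBp j).2.2.2.2⟩,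
    hSBH, hTBH, ?_⟩
  · -- persistence
    intro ε hε
    filter_upwards [hT₂.eventually (hpers ε hε)] with j hj i v
    exact ⟨fun h => hgS0sub _ i (hj (false, i) v h), fun h => hgT0sub _ i (hj (true, i) v h)⟩
  · -- containment
    intro ε hε
    filter_upwards [hT₂.eventually (hcont ε hε)] with j hj
    constructor
    · intro v hv
      obtain ⟨i, hi⟩ := (hgS0 _ v).1 hv
      exact ⟨i, hj (false, i) v hi⟩
    · intro v hv
      obtain ⟨i, hi⟩ := (hgT0 _ v).1 hv
      exact ⟨i, hj (true, i) v hi⟩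
  · -- compacts
    intro K hK hdS hdT
    have hd : ∀ p : Bool × Fin N, Disjoint K {z : ℂ | ∀ ℓ : Fin 3, |skewCoord ℓ (z - C p)| ≤ ϱ p} := by
      rintro ⟨β, i⟩; cases β
      · exact hdS i
      · exact hdT i
    filter_upwards [hT₂.eventually (hcomp K hK hd)] with j hj v hv
    rcases hv with hv | hv
    · obtain ⟨i, hi⟩ := (hgS0 _ v).1 hv
      exact hj (false, i) v hi
    · obtain ⟨i, hi⟩ := (hgT0 _ v).1 hv
      exact hj (true, i) v hi
  · -- spine cores
    intro ε hε
    filter_upwards [hSScore ε hε, hTScore ε hε] with j h1 h2 v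
    exact ⟨h1 v, h2 v⟩
  · -- body cores
    intro ε hε
    filter_upwards [hSBcore ε hε, hTBcore ε hε] with j h1 h2 v
    exact ⟨h1 v, h2 v⟩

end Summit.CriticalPhenomena.SAWScalingLimit.Theorems.ObservableToSLE.TypeLadder

end
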